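import Summits.QuantumFields.YangMills.Theorems.FlatTubeReductionFibredBOFloor
import HarnessLib

/-!
# Fibred Born–Oppenheimer blocks — part 8: the DIAGONAL block for SIGNED slow profiles with a LINEAR dressed comparison function
# (route `FlatTubeReduction`, crux K1 `NearFlatRatioLaw` stmt-QuantumFields-24720, registered stub `stub_boRate` = FCL 23943's `BORateAll`;
# rung R2b1 = RECORD-label femto gap; no summit statement is proved here)

Seat `ym-line-ftr-p1` g6 (prover).  Part 1's Cauchy–Schwarz bound `T(f⊗Ω,f⊗Ω) ≤ ∫∫ (|f|√λ)k(|f|√λ)` dresses the slow profile by `|f|√λ`, which is NOT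
linear in `f`; the registered stub (`BORateAll`, clause (P5)) compares, for every linear combination of a 2-family, `⟨φ_a,Kφ_a⟩` with the one-site form of a
one-site function `g_a` that must be LINEAR in `a` — so the dressing has to be `g = f·√λ` (signed), at the price of the additive second-order slack the
clause (P5) provides (`+ C u²·Nμ₁·‖φ‖²`).  From the polarisation identity of part 7,
`T(f⊗Ω,f⊗Ω) = ∫∫ (f√λ)k(f√λ) + ½∫∫ f(c)k(c,c')f(c')·[(√λ(c) − √λ(c'))² − transportSq Ω c c']`,
and the bracket is SECOND order in the slow increment (variation of the frozen fibre energy across one kinetic step, and the transport defect), so Schur's test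
on the defect kernel `k·[(√λ−√λ')² + transportSq]` (rows `≤ D`) gives
* ★ `fibredForm_prod_eq_linear` — the identity above;
* ★★ `fibredForm_prod_le_linear` — `T(f⊗Ω,f⊗Ω) ≤ ∫∫ (f√λ)k(f√λ) + ½·D·∫ f² dν` for EVERY (signed) slow profile `f`: the door's (P5) in model form with the
  LINEAR dressed profile `g = f√λ` and slack `½D = O(β^{−1}) ≪ λ_b(L³β)²`.
Integrability side conditions are hypotheses.  HONEST FRAMING: elementary algebra/measure theory for the registered stub of a crux of the CONDITIONAL reduction route
to the femto rung R2b1 (RECORD label); the chart and the frozen fibre ground states are OPEN (route RED lane A C4-CORE + the rate twin); nothing here is infinite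
volume, a continuum limit or the Clay mass gap.  No definitions, no named facts, no `sorry`.

## References
* B. Helffer, *Spectral Theory and its Applications*, CUP 2013, Lemma 7.1 (Schur's test) — [cite: Helffer2013, Lemma 7.1 pp.77–78].
* S. J. Gustafson, I. M. Sigal, *Mathematical Concepts of Quantum Mechanics*, Springer 2003, §12 — [cite: GustafsonSigal2003, §12].
-/

set_option autoImplicit false

noncomputable section

open MeasureTheory

namespace Summit.QuantumFields.YangMills.Theorems.FemtoTransferGap.FibredBO

variable {C Q Z : Type*} [MeasurableSpace C] [MeasurableSpace Q] [MeasurableSpace Z]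
variable {ν : Measure C} {π : Measure Q} {ρ : Measure Z} [SFinite ν] [SFinite π] [SFinite ρ]
variable {k : C → C → ℝ} {s : C → Q → Z → ℝ}

omit [SFinite ν] [SFinite π] [SFinite ρ] in
/-- ★ **Linear-dressing identity**: with `λ(c) = E_c(Ω_c)`,
`T(f⊗Ω,f⊗Ω) = ∫∫ k(c,c')·[(f√λ)(c)(f√λ)(c') + ½ f(c)f(c')((√λ(c) − √λ(c'))² − transportSq Ω c c')]`. [folklore] -/
theorem fibredForm_prod_eq_linear (f : C → ℝ) (Ω : C → Q → ℝ) (hΩ : ∀ c, MemLp (halfT π s c (Ω c)) 2 ρ) :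
    fibredForm ν π ρ k s (fun x => f x.1 * Ω x.1 x.2) (fun x => f x.1 * Ω x.1 x.2) =
      ∫ c, ∫ c', k c c' * ((f c * Real.sqrt (fibreEnergy π ρ s c (Ω c))) * (f c' * Real.sqrt (fibreEnergy π ρ s c' (Ω c'))) +
        (1 / 2) * (f c * f c') * ((Real.sqrt (fibreEnergy π ρ s c (Ω c)) - Real.sqrt (fibreEnergy π ρ s c' (Ω c'))) ^ 2 -
          transportSq π ρ s Ω c c')) ∂ν ∂ν := by
  rw [fibredForm_prod_eq_polar f Ω hΩ]
  refine integral_congr_ae (ae_of_all _ fun c => integral_congr_ae (ae_of_all _ fun c' => ?_))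
  dsimp only
  have h1 : Real.sqrt (fibreEnergy π ρ s c (Ω c)) ^ 2 = fibreEnergy π ρ s c (Ω c) := Real.sq_sqrt (fibreEnergy_nonneg c (Ω c))
  have h2 : Real.sqrt (fibreEnergy π ρ s c' (Ω c')) ^ 2 = fibreEnergy π ρ s c' (Ω c') := Real.sq_sqrt (fibreEnergy_nonneg c' (Ω c'))
  linear_combination (-(k c c' * (f c * f c') / 2)) * h1 + (-(k c c' * (f c * f c') / 2)) * h2

omit [SFinite π] [SFinite ρ] in
/-- ★★ **DIAGONAL block with LINEAR dressing (the door's (P5) in model form)**: for a nonnegative symmetric slow kernel `k`, ANY slow profile `f`, fibre profiles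
`Ω_c` with `λ(c) = E_c(Ω_c)`, and a row bound `D` of the (nonnegative, symmetric) defect kernel `k(c,c')·[(√λ(c) − √λ(c'))² + transportSq Ω c c']`:
`T(f⊗Ω,f⊗Ω) ≤ ∫∫ (f√λ)(c)k(c,c')(f√λ)(c') dν dν + ½·D·∫ f² dν`. [cite: Helffer2013, Lemma 7.1 pp.77–78] [cite: GustafsonSigal2003, §12] -/
theorem fibredForm_prod_le_linear (hk : ∀ c c', 0 ≤ k c c') (hksymm : ∀ c c', k c c' = k c' c) (f : C → ℝ) (Ω : C → Q → ℝ) {D : ℝ}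
    (hΩ : ∀ c, MemLp (halfT π s c (Ω c)) 2 ρ) (htsymm : ∀ c c', transportSq π ρ s Ω c c' = transportSq π ρ s Ω c' c)
    (hrow : ∀ᵐ c ∂ν, ∫ c', k c c' * ((Real.sqrt (fibreEnergy π ρ s c (Ω c)) - Real.sqrt (fibreEnergy π ρ s c' (Ω c'))) ^ 2 +
      transportSq π ρ s Ω c c') ∂ν ≤ D)
    (hf2 : Integrable (fun c => f c ^ 2) ν)
    (hJ : Integrable (fun p : C × C => k p.1 p.2 * ((f p.1 * Real.sqrt (fibreEnergy π ρ s p.1 (Ω p.1))) *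
      (f p.2 * Real.sqrt (fibreEnergy π ρ s p.2 (Ω p.2))))) (ν.prod ν))
    (hR : Integrable (fun p : C × C => k p.1 p.2 * ((1 / 2) * (f p.1 * f p.2) *
      ((Real.sqrt (fibreEnergy π ρ s p.1 (Ω p.1)) - Real.sqrt (fibreEnergy π ρ s p.2 (Ω p.2))) ^ 2 - transportSq π ρ s Ω p.1 p.2))) (ν.prod ν))
    (hS : Integrable (fun p : C × C => |f p.1| * (k p.1 p.2 * ((Real.sqrt (fibreEnergy π ρ s p.1 (Ω p.1)) -
      Real.sqrt (fibreEnergy π ρ s p.2 (Ω p.2))) ^ 2 + transportSq π ρ s Ω p.1 p.2)) * |f p.2|) (ν.prod ν))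
    (hS₁ : Integrable (fun p : C × C => (k p.1 p.2 * ((Real.sqrt (fibreEnergy π ρ s p.1 (Ω p.1)) -
      Real.sqrt (fibreEnergy π ρ s p.2 (Ω p.2))) ^ 2 + transportSq π ρ s Ω p.1 p.2)) * |f p.1| ^ 2) (ν.prod ν))
    (hS₂ : Integrable (fun p : C × C => (k p.1 p.2 * ((Real.sqrt (fibreEnergy π ρ s p.1 (Ω p.1)) -
      Real.sqrt (fibreEnergy π ρ s p.2 (Ω p.2))) ^ 2 + transportSq π ρ s Ω p.1 p.2)) * |f p.2| ^ 2) (ν.prod ν)) :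
    fibredForm ν π ρ k s (fun x => f x.1 * Ω x.1 x.2) (fun x => f x.1 * Ω x.1 x.2) ≤
      (∫ c, ∫ c', k c c' * ((f c * Real.sqrt (fibreEnergy π ρ s c (Ω c))) * (f c' * Real.sqrt (fibreEnergy π ρ s c' (Ω c')))) ∂ν ∂ν) +
        (1 / 2) * D * ∫ c, f c ^ 2 ∂ν := by
  -- abbreviations (documentation only): λ(c) = E_c(Ω_c); W = k·[(√λ−√λ')² + transportSq]
  have hW0 : ∀ p : C × C, 0 ≤ k p.1 p.2 * ((Real.sqrt (fibreEnergy π ρ s p.1 (Ω p.1)) - Real.sqrt (fibreEnergy π ρ s p.2 (Ω p.2))) ^ 2 +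
      transportSq π ρ s Ω p.1 p.2) := fun p =>
    mul_nonneg (hk p.1 p.2) (add_nonneg (sq_nonneg _) (transportSq_nonneg Ω p.1 p.2))
  have hWsymm : ∀ c c', k c c' * ((Real.sqrt (fibreEnergy π ρ s c (Ω c)) - Real.sqrt (fibreEnergy π ρ s c' (Ω c'))) ^ 2 + transportSq π ρ s Ω c c') =
      k c' c * ((Real.sqrt (fibreEnergy π ρ s c' (Ω c')) - Real.sqrt (fibreEnergy π ρ s c (Ω c))) ^ 2 + transportSq π ρ s Ω c' c) := by
    intro c c'
    rw [hksymm c c', htsymm c c', ← neg_sub (Real.sqrt (fibreEnergy π ρ s c' (Ω c'))) (Real.sqrt (fibreEnergy π ρ s c (Ω c))), neg_sq]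
  -- the full integrand on the product measure
  have hI0 : Integrable (fun p : C × C => k p.1 p.2 * ((f p.1 * Real.sqrt (fibreEnergy π ρ s p.1 (Ω p.1))) * (f p.2 * Real.sqrt (fibreEnergy π ρ s p.2 (Ω p.2))) +
      (1 / 2) * (f p.1 * f p.2) * ((Real.sqrt (fibreEnergy π ρ s p.1 (Ω p.1)) - Real.sqrt (fibreEnergy π ρ s p.2 (Ω p.2))) ^ 2 -
        transportSq π ρ s Ω p.1 p.2))) (ν.prod ν) := by
    refine (hJ.add hR).congr (ae_of_all _ fun p => ?_)
    simp only [Pi.add_apply]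
    ring
  have e0 : ∫ c, ∫ c', k c c' * ((f c * Real.sqrt (fibreEnergy π ρ s c (Ω c))) * (f c' * Real.sqrt (fibreEnergy π ρ s c' (Ω c'))) +
      (1 / 2) * (f c * f c') * ((Real.sqrt (fibreEnergy π ρ s c (Ω c)) - Real.sqrt (fibreEnergy π ρ s c' (Ω c'))) ^ 2 -
        transportSq π ρ s Ω c c')) ∂ν ∂ν =
      ∫ p, k p.1 p.2 * ((f p.1 * Real.sqrt (fibreEnergy π ρ s p.1 (Ω p.1))) * (f p.2 * Real.sqrt (fibreEnergy π ρ s p.2 (Ω p.2))) +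
      (1 / 2) * (f p.1 * f p.2) * ((Real.sqrt (fibreEnergy π ρ s p.1 (Ω p.1)) - Real.sqrt (fibreEnergy π ρ s p.2 (Ω p.2))) ^ 2 -
        transportSq π ρ s Ω p.1 p.2)) ∂(ν.prod ν) := integral_integral hI0
  have e1 : ∫ c, ∫ c', k c c' * ((f c * Real.sqrt (fibreEnergy π ρ s c (Ω c))) * (f c' * Real.sqrt (fibreEnergy π ρ s c' (Ω c')))) ∂ν ∂ν =
      ∫ p, k p.1 p.2 * ((f p.1 * Real.sqrt (fibreEnergy π ρ s p.1 (Ω p.1))) * (f p.2 * Real.sqrt (fibreEnergy π ρ s p.2 (Ω p.2)))) ∂(ν.prod ν) :=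
    integral_integral hJ
  have e2 : ∫ p, k p.1 p.2 * ((f p.1 * Real.sqrt (fibreEnergy π ρ s p.1 (Ω p.1))) * (f p.2 * Real.sqrt (fibreEnergy π ρ s p.2 (Ω p.2))) +
      (1 / 2) * (f p.1 * f p.2) * ((Real.sqrt (fibreEnergy π ρ s p.1 (Ω p.1)) - Real.sqrt (fibreEnergy π ρ s p.2 (Ω p.2))) ^ 2 -
        transportSq π ρ s Ω p.1 p.2)) ∂(ν.prod ν) =
      (∫ p, k p.1 p.2 * ((f p.1 * Real.sqrt (fibreEnergy π ρ s p.1 (Ω p.1))) * (f p.2 * Real.sqrt (fibreEnergy π ρ s p.2 (Ω p.2)))) ∂(ν.prod ν)) +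
        ∫ p, k p.1 p.2 * ((1 / 2) * (f p.1 * f p.2) *
          ((Real.sqrt (fibreEnergy π ρ s p.1 (Ω p.1)) - Real.sqrt (fibreEnergy π ρ s p.2 (Ω p.2))) ^ 2 - transportSq π ρ s Ω p.1 p.2)) ∂(ν.prod ν) := by
    rw [← integral_add hJ hR]
    refine integral_congr_ae (ae_of_all _ fun p => ?_)
    ring
  -- the remainder is at most ½ ∫∫ |f| W |f|
  have hrem : ∫ p, k p.1 p.2 * ((1 / 2) * (f p.1 * f p.2) *
      ((Real.sqrt (fibreEnergy π ρ s p.1 (Ω p.1)) - Real.sqrt (fibreEnergy π ρ s p.2 (Ω p.2))) ^ 2 - transportSq π ρ s Ω p.1 p.2)) ∂(ν.prod ν) ≤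
      ∫ p, (1 / 2) * (|f p.1| * (k p.1 p.2 * ((Real.sqrt (fibreEnergy π ρ s p.1 (Ω p.1)) -
        Real.sqrt (fibreEnergy π ρ s p.2 (Ω p.2))) ^ 2 + transportSq π ρ s Ω p.1 p.2)) * |f p.2|) ∂(ν.prod ν) := by
    refine integral_mono hR (hS.const_mul (1 / 2)) fun p => ?_
    dsimp only
    have hT0 := transportSq_nonneg (π := π) (ρ := ρ) (s := s) Ω p.1 p.2
    have hsq0 : 0 ≤ (Real.sqrt (fibreEnergy π ρ s p.1 (Ω p.1)) - Real.sqrt (fibreEnergy π ρ s p.2 (Ω p.2))) ^ 2 := sq_nonneg _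
    have hk0 := hk p.1 p.2
    have hff : f p.1 * f p.2 ≤ |f p.1| * |f p.2| := by
      rw [← abs_mul]; exact le_abs_self _
    have hff' : -(|f p.1| * |f p.2|) ≤ f p.1 * f p.2 := by
      rw [← abs_mul]; exact neg_abs_le _
    nlinarith [mul_nonneg hk0 hsq0, mul_nonneg hk0 hT0, mul_nonneg (mul_nonneg hk0 hsq0) (sub_nonneg.2 hff),
      mul_nonneg (mul_nonneg hk0 hT0) (neg_le_iff_add_nonneg'.1 hff')]
  -- Schur on the defect kernel
  have hschur := Literature.Analysis.OperatorTheory.SchurTest.integral_integral_mul_kernel_mul_self_le_of_symm (μ := ν)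
      (fun c c' => k c c' * ((Real.sqrt (fibreEnergy π ρ s c (Ω c)) - Real.sqrt (fibreEnergy π ρ s c' (Ω c'))) ^ 2 + transportSq π ρ s Ω c c'))
      (fun c => |f c|) (fun c c' => hW0 (c, c')) hWsymm hrow (hf2.congr (ae_of_all _ fun c => (sq_abs (f c)).symm)) hS hS₁ hS₂
  have e3 : ∫ p, (1 / 2) * (|f p.1| * (k p.1 p.2 * ((Real.sqrt (fibreEnergy π ρ s p.1 (Ω p.1)) -
        Real.sqrt (fibreEnergy π ρ s p.2 (Ω p.2))) ^ 2 + transportSq π ρ s Ω p.1 p.2)) * |f p.2|) ∂(ν.prod ν) =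
      (1 / 2) * ∫ c, ∫ c', |f c| * (k c c' * ((Real.sqrt (fibreEnergy π ρ s c (Ω c)) -
        Real.sqrt (fibreEnergy π ρ s c' (Ω c'))) ^ 2 + transportSq π ρ s Ω c c')) * |f c'| ∂ν ∂ν := by
    rw [integral_const_mul]
    congr 1
    exact (integral_integral (f := fun c c' => |f c| * (k c c' * ((Real.sqrt (fibreEnergy π ρ s c (Ω c)) -
        Real.sqrt (fibreEnergy π ρ s c' (Ω c'))) ^ 2 + transportSq π ρ s Ω c c')) * |f c'|) hS).symm
  have e4 : ∫ c, |f c| ^ 2 ∂ν = ∫ c, f c ^ 2 ∂ν := integral_congr_ae (ae_of_all _ fun c => sq_abs (f c))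
  rw [fibredForm_prod_eq_linear f Ω hΩ, e0, e1, e2]
  rw [e4] at hschur
  have hR' : ∫ p, k p.1 p.2 * ((1 / 2) * (f p.1 * f p.2) *
      ((Real.sqrt (fibreEnergy π ρ s p.1 (Ω p.1)) - Real.sqrt (fibreEnergy π ρ s p.2 (Ω p.2))) ^ 2 - transportSq π ρ s Ω p.1 p.2)) ∂(ν.prod ν) ≤
      (1 / 2) * D * ∫ c, f c ^ 2 ∂ν := by
    refine hrem.trans ?_
    rw [e3]
    nlinarith [hschur]
  linarith [hR']

end Summit.QuantumFields.YangMills.Theorems.FemtoTransferGap.FibredBO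

end
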